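import Literature.GroupTheory.CombinatorialGroupTheory.PuncturedSurfaceGroupUnrQuotientCoprod
import Literature.GroupTheory.CombinatorialGroupTheory.PuncturedSurfaceGroupThreeChainBases
import HarnessLib

/-!
# The unramified quotient of the three-component CHAIN degeneration: `Γ_{g,r}/⟨⟨c_j, ε_A, η⟩⟩ ≅ Γ_{g₀,0} ∗ (Γ_{g₁,0} ∗ Γ_{g₂,0})`

Topic `Literature/GroupTheory/CombinatorialGroupTheory`; theorems only (a Tietze computation).  [CombGC]
Def. 1.1 (ii) p. 7 (the unramified quotient `Π^unr_G`) [cite: MochizukiCombGC2007, Def 1.1(ii) p.7] at the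
THREE-COMPONENT CHAIN data of abc-iut-f-164 (`PSCThreeChainShape.lean`: a pointed stable curve
`C₀ ∪_{ν_A} C_mid ∪_{ν_B} C₁`, `Γ_{g,r}` with `g = g₀ + (g₁ + g₂)`, handles `i < g₀` / `g₀ ≤ i < g₀ + g₁` /
`i ≥ g₀ + g₁` on `C₀` / `C_mid` / `C₁`, node loops `ε_A = (c_{s₂}⋯c_{r−1})·∏_{i<g₀}[a_i,b_i]` and
`η = (c_{s₁}⋯c_{r−1})·∏_{i<g₀+g₁}[a_i,b_i]`): killing every cusp generator `c_j` and both node loops kills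
`∏_{i<g₀}[a_i,b_i]`, then `∏_{g₀≤i<g₀+g₁}[a_i,b_i]`, and then, by the relator, `∏_{i≥g₀+g₁}[a_i,b_i]`; what is
left is the free product of the three CLOSED surface groups.

* `exists_mulEquiv_coprod_quotient_inr` — quotienting a free product `A ∗ C` by relators taken in the
  factor `C`: `(A ∗ C)/⟨⟨inr S⟩⟩ ≃* A ∗ (C/⟨⟨S⟩⟩)` (universal properties of `Monoid.Coprod` and of the quotient);
* `exists_mulEquiv_chainUnrQuotient_coprod` — for `g = g₀ + (g₁ + g₂)` an isomorphism
  `Γ_{g,r} ⧸ ⟨⟨{ε_A, η} ∪ {c_j}⟩⟩ ≃* Γ_{g₀,0} ∗ (Γ_{g₁,0} ∗ Γ_{g₂,0})` with `[a_i], [b_i] ↦ inl ·` (`i = castAdd _ i₀`),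
  `↦ inr (inl ·)` (`i = natAdd g₀ (castAdd g₂ j)`), `↦ inr (inr ·)` (`i = natAdd g₀ (natAdd g₁ k)`).  Obtained by
  ITERATING abc-iut-f-166's two-component computation `exists_mulEquiv_unrQuotient_coprod` (first at the node
  `ν_A`, then — inside the second factor `Γ_{g₁+g₂,0}`, where `η` becomes `∏_{j<g₁}[a_j,b_j]` — at `ν_B`) along
  Noether's third isomorphism theorem.

Step (i) of the `Π^unr`-separating-covering programme (door D1 of abc-iut-f-166 / abc-iut-w5-d047) at
two-node data; elementary; nothing here concerns [IUTchIII].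
-/

namespace Literature.GroupTheory.CombinatorialGroupTheory

open Monoid (Coprod)

/-! ### Quotient of a free product by relators from one factor -/

section CoprodQuotient

variable {A C : Type*} [Group A] [Group C]

/-- **`(A ∗ C)/⟨⟨inr S⟩⟩ ≃* A ∗ (C/⟨⟨S⟩⟩)`**: quotienting a free product by the normal closure of relators
lying in the factor `C` is the free product with the quotient factor; `[inl a] ↦ inl a`, `[inr x] ↦ inr [x]`.
(Both directions by the universal properties; the compositions are the identity on generators.)
[cite: SerreTrees1980, I §1.2 Prop. 2] -/
theorem exists_mulEquiv_coprod_quotient_inr (S : Set C) :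
    ∃ e : Coprod A C ⧸ Subgroup.normalClosure ((Coprod.inr : C →* Coprod A C) '' S) ≃*
        Coprod A (C ⧸ Subgroup.normalClosure S),
      (∀ a : A, e (QuotientGroup.mk (Coprod.inl a)) = Coprod.inl a) ∧
      ∀ x : C, e (QuotientGroup.mk (Coprod.inr x)) = Coprod.inr (QuotientGroup.mk x) := by
  set N : Subgroup C := Subgroup.normalClosure S with hN
  set M : Subgroup (Coprod A C) := Subgroup.normalClosure ((Coprod.inr : C →* Coprod A C) '' S) with hM
  -- `Φ : (A ∗ C)/M → A ∗ (C/N)`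
  let φ : Coprod A C →* Coprod A (C ⧸ N) := Coprod.map (MonoidHom.id A) (QuotientGroup.mk' N)
  have hMφ : M ≤ φ.ker := by
    refine Subgroup.normalClosure_le_normal ?_
    rintro _ ⟨s, hs, rfl⟩
    rw [SetLike.mem_coe, MonoidHom.mem_ker, Coprod.map_apply_inr, QuotientGroup.mk'_apply,
      (QuotientGroup.eq_one_iff s).mpr (Subgroup.subset_normalClosure hs), map_one]
  let Φ : Coprod A C ⧸ M →* Coprod A (C ⧸ N) := QuotientGroup.lift M φ hMφ
  have hΦ : ∀ x, Φ (QuotientGroup.mk x) = φ x := fun x => QuotientGroup.lift_mk' M hMφ x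
  -- `Ψ : A ∗ (C/N) → (A ∗ C)/M`
  have hNψ : N ≤ ((QuotientGroup.mk' M).comp (Coprod.inr : C →* Coprod A C)).ker := by
    refine Subgroup.normalClosure_le_normal ?_
    intro s hs
    rw [SetLike.mem_coe, MonoidHom.mem_ker, MonoidHom.comp_apply, QuotientGroup.mk'_apply,
      QuotientGroup.eq_one_iff]
    exact Subgroup.subset_normalClosure ⟨s, hs, rfl⟩
  let Ψ : Coprod A (C ⧸ N) →* Coprod A C ⧸ M :=
    Coprod.lift ((QuotientGroup.mk' M).comp Coprod.inl) (QuotientGroup.lift N _ hNψ)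
  have hΨl : ∀ a : A, Ψ (Coprod.inl a) = QuotientGroup.mk (Coprod.inl a) := fun a => by
    change Coprod.lift _ _ (Coprod.inl a) = _
    rw [Coprod.lift_apply_inl]; rfl
  have hΨr : ∀ x : C, Ψ (Coprod.inr (QuotientGroup.mk x)) = QuotientGroup.mk (Coprod.inr x) := fun x => by
    change Coprod.lift _ _ (Coprod.inr (QuotientGroup.mk x)) = _
    rw [Coprod.lift_apply_inr, QuotientGroup.lift_mk]; rfl
  have h1 : Ψ.comp Φ = MonoidHom.id _ := by
    refine QuotientGroup.monoidHom_ext _ (Coprod.hom_ext (MonoidHom.ext fun a => ?_)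
      (MonoidHom.ext fun x => ?_))
    · change Ψ (Φ (QuotientGroup.mk (Coprod.inl a))) = QuotientGroup.mk (Coprod.inl a)
      rw [hΦ, Coprod.map_apply_inl, MonoidHom.id_apply, hΨl]
    · change Ψ (Φ (QuotientGroup.mk (Coprod.inr x))) = QuotientGroup.mk (Coprod.inr x)
      rw [hΦ, Coprod.map_apply_inr, QuotientGroup.mk'_apply, hΨr]
  have h2 : Φ.comp Ψ = MonoidHom.id _ := by
    refine Coprod.hom_ext (MonoidHom.ext fun a => ?_)
      (QuotientGroup.monoidHom_ext _ (MonoidHom.ext fun x => ?_))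
    · change Φ (Ψ (Coprod.inl a)) = Coprod.inl a
      rw [hΨl, hΦ, Coprod.map_apply_inl, MonoidHom.id_apply]
    · change Φ (Ψ (Coprod.inr (QuotientGroup.mk x))) = Coprod.inr (QuotientGroup.mk x)
      rw [hΨr, hΦ, Coprod.map_apply_inr, QuotientGroup.mk'_apply]
  refine ⟨MonoidHom.toMulEquiv Φ Ψ h1 h2, fun a => ?_, fun x => ?_⟩
  · rw [MonoidHom.toMulEquiv_apply, hΦ, Coprod.map_apply_inl, MonoidHom.id_apply]
  · rw [MonoidHom.toMulEquiv_apply, hΦ, Coprod.map_apply_inr, QuotientGroup.mk'_apply]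

end CoprodQuotient

/-! ### The chain computation -/

namespace PuncturedSurfaceGroup

/-- **`Γ_{g₀+(g₁+g₂),r} ⧸ ⟨⟨ε_A, η, c_0, …, c_{r−1}⟩⟩ ≅ Γ_{g₀,0} ∗ (Γ_{g₁,0} ∗ Γ_{g₂,0})`** for the two node loops
`ε_A = (c_{s₂}⋯c_{r−1})·∏_{i<g₀}[a_i,b_i]`, `η = (c_{s₁}⋯c_{r−1})·∏_{i<g₀+g₁}[a_i,b_i]` of the three-component
chain degeneration, with the evident values on the handle generators of the three components.
[cite: MochizukiCombGC2007, Def 1.1(ii) p.7] -/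
theorem exists_mulEquiv_chainUnrQuotient_coprod (g₀ g₁ g₂ r s₁ s₂ : ℕ)
    (εA η : PuncturedSurfaceGroup (g₀ + (g₁ + g₂)) r)
    (hεA : εA = ((List.finRange r).map fun j : Fin r =>
        if s₂ ≤ (j : ℕ) then c (g := g₀ + (g₁ + g₂)) j else 1).prod *
      ((List.finRange (g₀ + (g₁ + g₂))).map fun i : Fin (g₀ + (g₁ + g₂)) => if (i : ℕ) < g₀ then
        a (r := r) i * b i * (a i)⁻¹ * (b i)⁻¹ else 1).prod)
    (hη : η = ((List.finRange r).map fun j : Fin r =>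
        if s₁ ≤ (j : ℕ) then c (g := g₀ + (g₁ + g₂)) j else 1).prod *
      ((List.finRange (g₀ + (g₁ + g₂))).map fun i : Fin (g₀ + (g₁ + g₂)) => if (i : ℕ) < g₀ + g₁ then
        a (r := r) i * b i * (a i)⁻¹ * (b i)⁻¹ else 1).prod) :
    ∃ (_hK : (Subgroup.normalClosure ({εA, η} ∪
        Set.range (c : Fin r → PuncturedSurfaceGroup (g₀ + (g₁ + g₂)) r))).Normal)
      (e : PuncturedSurfaceGroup (g₀ + (g₁ + g₂)) r ⧸
          Subgroup.normalClosure ({εA, η} ∪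
            Set.range (c : Fin r → PuncturedSurfaceGroup (g₀ + (g₁ + g₂)) r)) ≃*
        Coprod (PuncturedSurfaceGroup g₀ 0)
          (Coprod (PuncturedSurfaceGroup g₁ 0) (PuncturedSurfaceGroup g₂ 0))),
      (∀ (i : Fin g₀) (bit : Bool),
        e (QuotientGroup.mk (PresentedGroup.of (Sum.inl (Fin.castAdd (g₁ + g₂) i, bit)))) =
          Coprod.inl (PresentedGroup.of (Sum.inl (i, bit)))) ∧
      (∀ (j : Fin g₁) (bit : Bool),
        e (QuotientGroup.mk (PresentedGroup.of (Sum.inl (Fin.natAdd g₀ (Fin.castAdd g₂ j), bit)))) =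
          Coprod.inr (Coprod.inl (PresentedGroup.of (Sum.inl (j, bit))))) ∧
      ∀ (k : Fin g₂) (bit : Bool),
        e (QuotientGroup.mk (PresentedGroup.of (Sum.inl (Fin.natAdd g₀ (Fin.natAdd g₁ k), bit)))) =
          Coprod.inr (Coprod.inr (PresentedGroup.of (Sum.inl (k, bit)))) := by
  classical
  set K₁ : Subgroup (PuncturedSurfaceGroup (g₀ + (g₁ + g₂)) r) :=
    Subgroup.normalClosure ({εA} ∪ Set.range (c : Fin r → PuncturedSurfaceGroup (g₀ + (g₁ + g₂)) r))
    with hK₁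
  set K : Subgroup (PuncturedSurfaceGroup (g₀ + (g₁ + g₂)) r) :=
    Subgroup.normalClosure ({εA, η} ∪ Set.range (c : Fin r → PuncturedSurfaceGroup (g₀ + (g₁ + g₂)) r))
    with hK
  haveI hKn : K.Normal := Subgroup.normalClosure_normal
  -- (1) the first node: `Γ/K₁ ≅ Γ_{g₀,0} ∗ Γ_{g₁+g₂,0}`
  obtain ⟨hK₁n, e₁, he₁l, he₁r⟩ := exists_mulEquiv_unrQuotient_coprod g₀ (g₁ + g₂) r s₂ εA hεA
  have hcK₁ : ∀ j, c (g := g₀ + (g₁ + g₂)) (r := r) j ∈ K₁ := fun j =>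
    Subgroup.subset_normalClosure (Or.inr ⟨j, rfl⟩)
  have hεAK₁ : εA ∈ K₁ := Subgroup.subset_normalClosure (Or.inl rfl)
  have hK₁K : K₁ ≤ K :=
    Subgroup.normalClosure_mono (Set.union_subset_union_left _
      (Set.singleton_subset_iff.mpr (Set.mem_insert εA {η})))
  -- the composite `θ = e₁ ∘ [·] : Γ → Γ_{g₀,0} ∗ Γ_{g₁+g₂,0}` on generators
  set θ : PuncturedSurfaceGroup (g₀ + (g₁ + g₂)) r →*
      Coprod (PuncturedSurfaceGroup g₀ 0) (PuncturedSurfaceGroup (g₁ + g₂) 0) :=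
    e₁.toMonoidHom.comp (QuotientGroup.mk' K₁) with hθ
  have hθapply : ∀ x, θ x = e₁ (QuotientGroup.mk x) := fun x => rfl
  have hθa : ∀ j : Fin (g₁ + g₂), θ (a (r := r) (Fin.natAdd g₀ j)) = Coprod.inr (a j) :=
    fun j => he₁r j false
  have hθb : ∀ j : Fin (g₁ + g₂), θ (b (r := r) (Fin.natAdd g₀ j)) = Coprod.inr (b j) :=
    fun j => he₁r j true
  -- the second node loop read in `Γ_{g₁+g₂,0}`
  set εB : PuncturedSurfaceGroup (g₁ + g₂) 0 :=
    ((List.finRange 0).map fun j : Fin 0 => if 0 ≤ (j : ℕ) then c (g := g₁ + g₂) j else 1).prod *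
      ((List.finRange (g₁ + g₂)).map fun i : Fin (g₁ + g₂) => if (i : ℕ) < g₁ then
        a (r := 0) i * b i * (a i)⁻¹ * (b i)⁻¹ else 1).prod with hεB
  have hθη : θ η = Coprod.inr εB := by
    have hX₀ : ((List.finRange (g₀ + (g₁ + g₂))).map fun i : Fin (g₀ + (g₁ + g₂)) => if (i : ℕ) < g₀ then
        a (r := r) i * b i * (a i)⁻¹ * (b i)⁻¹ else 1).prod ∈ K₁ := by
      have hC : ((List.finRange r).map fun j : Fin r =>
          if s₂ ≤ (j : ℕ) then c (g := g₀ + (g₁ + g₂)) j else 1).prod ∈ K₁ :=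
        prod_map_finRange_ite_mem K₁ r _ _ fun j _ => hcK₁ j
      have heq : ((List.finRange (g₀ + (g₁ + g₂))).map fun i : Fin (g₀ + (g₁ + g₂)) => if (i : ℕ) < g₀ then
          a (r := r) i * b i * (a i)⁻¹ * (b i)⁻¹ else 1).prod =
          (((List.finRange r).map fun j : Fin r =>
            if s₂ ≤ (j : ℕ) then c (g := g₀ + (g₁ + g₂)) j else 1).prod)⁻¹ * εA := by
        rw [hεA, inv_mul_cancel_left]
      rw [heq]
      exact K₁.mul_mem (K₁.inv_mem hC) hεAK₁
    rw [hη, map_mul, comm_prod_lt_split g₀ (g₀ + g₁) (Nat.le_add_right _ _), map_mul,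
      hθapply ((List.finRange r).map _).prod,
      (QuotientGroup.eq_one_iff _).mpr (prod_map_finRange_ite_mem K₁ r _ _ fun j _ => hcK₁ j), map_one,
      one_mul, hθapply ((List.finRange (g₀ + (g₁ + g₂))).map fun i : Fin (g₀ + (g₁ + g₂)) =>
        if (i : ℕ) < g₀ then a (r := r) i * b i * (a i)⁻¹ * (b i)⁻¹ else 1).prod,
      (QuotientGroup.eq_one_iff _).mpr hX₀, map_one, one_mul, prod_map_finRange_add, map_mul]
    have h1 : ((List.finRange g₀).map fun i : Fin g₀ =>
        (fun i : Fin (g₀ + (g₁ + g₂)) => if g₀ ≤ (i : ℕ) ∧ (i : ℕ) < g₀ + g₁ then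
          a (r := r) i * b i * (a i)⁻¹ * (b i)⁻¹ else 1) (Fin.castAdd (g₁ + g₂) i)).prod = 1 :=
      List.prod_eq_one fun y hy => by
        obtain ⟨i, -, rfl⟩ := List.mem_map.mp hy
        have hi : ¬ (g₀ ≤ ((Fin.castAdd (g₁ + g₂) i : Fin (g₀ + (g₁ + g₂))) : ℕ) ∧
            ((Fin.castAdd (g₁ + g₂) i : Fin (g₀ + (g₁ + g₂))) : ℕ) < g₀ + g₁) := by
          simp only [Fin.val_castAdd]; omega
        simp only [if_neg hi]
    rw [h1, map_one, one_mul, map_list_prod, List.map_map, hεB, List.finRange_zero, List.map_nil,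
      List.prod_nil, one_mul, map_list_prod, List.map_map]
    congr 1
    refine List.map_congr_left fun j _ => ?_
    by_cases hj : (j : ℕ) < g₁
    · have hc : g₀ ≤ ((Fin.natAdd g₀ j : Fin (g₀ + (g₁ + g₂))) : ℕ) ∧
          ((Fin.natAdd g₀ j : Fin (g₀ + (g₁ + g₂))) : ℕ) < g₀ + g₁ := by
        simp only [Fin.val_natAdd]; omega
      simp only [Function.comp_apply, if_pos hc, if_pos hj, map_mul, map_inv, hθa, hθb]
    · have hc : ¬ (g₀ ≤ ((Fin.natAdd g₀ j : Fin (g₀ + (g₁ + g₂))) : ℕ) ∧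
          ((Fin.natAdd g₀ j : Fin (g₀ + (g₁ + g₂))) : ℕ) < g₀ + g₁) := by
        simp only [Fin.val_natAdd]; omega
      simp only [Function.comp_apply, if_neg hc, if_neg hj, map_one]
  -- (2) `K/K₁ = ⟨⟨[η]⟩⟩`, transported by `e₁` to `⟨⟨inr ε_B⟩⟩`
  haveI hKmn : (K.map (QuotientGroup.mk' K₁)).Normal := hKn.map _ (QuotientGroup.mk'_surjective K₁)
  have hKmap : K.map (QuotientGroup.mk' K₁) = Subgroup.normalClosure {QuotientGroup.mk' K₁ η} := by
    rw [hK, Subgroup.map_normalClosure _ _ (QuotientGroup.mk'_surjective K₁)]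
    apply le_antisymm
    · refine Subgroup.normalClosure_le_normal ?_
      rintro _ ⟨x, hx, rfl⟩
      rcases hx with hx | ⟨j, rfl⟩
      · rcases Set.mem_insert_iff.mp hx with rfl | hx'
        · have h1 : QuotientGroup.mk' K₁ _ = 1 :=
            (QuotientGroup.mk'_apply K₁ _).trans ((QuotientGroup.eq_one_iff _).mpr hεAK₁)
          rw [SetLike.mem_coe, h1]
          exact Subgroup.one_mem _
        · rw [Set.mem_singleton_iff] at hx'
          subst hx'
          exact Subgroup.subset_normalClosure (Set.mem_singleton _)
      · have h1 : QuotientGroup.mk' K₁ (c j) = 1 :=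
          (QuotientGroup.mk'_apply K₁ _).trans ((QuotientGroup.eq_one_iff _).mpr (hcK₁ j))
        rw [SetLike.mem_coe, h1]
        exact Subgroup.one_mem _
    · exact Subgroup.normalClosure_mono (Set.singleton_subset_iff.mpr
        ⟨η, Or.inl (Set.mem_insert_of_mem εA (Set.mem_singleton η)), rfl⟩)
  have hcongr : (K.map (QuotientGroup.mk' K₁)).map
      (e₁ : PuncturedSurfaceGroup (g₀ + (g₁ + g₂)) r ⧸ K₁ →*
        Coprod (PuncturedSurfaceGroup g₀ 0) (PuncturedSurfaceGroup (g₁ + g₂) 0)) =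
      Subgroup.normalClosure {(Coprod.inr εB : Coprod (PuncturedSurfaceGroup g₀ 0)
        (PuncturedSurfaceGroup (g₁ + g₂) 0))} := by
    rw [hKmap, Subgroup.map_normalClosure _ _ (by exact e₁.surjective), Set.image_singleton]
    exact congrArg (fun z => Subgroup.normalClosure {z}) hθη
  -- (3) the second node inside the second factor: `Γ_{g₁+g₂,0}/⟨⟨ε_B⟩⟩ ≅ Γ_{g₁,0} ∗ Γ_{g₂,0}`
  obtain ⟨hK₂n, e₂, he₂l, he₂r⟩ := exists_mulEquiv_unrQuotient_coprod g₁ g₂ 0 0 εB hεB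
  have hK₂ : Subgroup.normalClosure ({εB} ∪ Set.range (c : Fin 0 → PuncturedSurfaceGroup (g₁ + g₂) 0)) =
      Subgroup.normalClosure {εB} := by
    rw [Set.range_eq_empty, Set.union_empty]
  haveI hK₂n' : (Subgroup.normalClosure ({εB} : Set (PuncturedSurfaceGroup (g₁ + g₂) 0))).Normal :=
    Subgroup.normalClosure_normal
  -- (4) the factor lemma
  obtain ⟨e₃, he₃l, he₃r⟩ :=
    exists_mulEquiv_coprod_quotient_inr (A := PuncturedSurfaceGroup g₀ 0) ({εB} : Set (PuncturedSurfaceGroup (g₁ + g₂) 0))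
  have himg : Subgroup.normalClosure {(Coprod.inr εB : Coprod (PuncturedSurfaceGroup g₀ 0)
        (PuncturedSurfaceGroup (g₁ + g₂) 0))} =
      Subgroup.normalClosure ((Coprod.inr : PuncturedSurfaceGroup (g₁ + g₂) 0 →*
        Coprod (PuncturedSurfaceGroup g₀ 0) (PuncturedSurfaceGroup (g₁ + g₂) 0)) '' {εB}) := by
    rw [Set.image_singleton]
  -- (5) assemble
  let T3 : Coprod (PuncturedSurfaceGroup g₀ 0) (PuncturedSurfaceGroup (g₁ + g₂) 0 ⧸
        Subgroup.normalClosure ({εB} : Set (PuncturedSurfaceGroup (g₁ + g₂) 0))) ≃*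
      Coprod (PuncturedSurfaceGroup g₀ 0) (Coprod (PuncturedSurfaceGroup g₁ 0) (PuncturedSurfaceGroup g₂ 0)) :=
    MulEquiv.coprodCongr (MulEquiv.refl _) ((QuotientGroup.quotientMulEquivOfEq hK₂.symm).trans e₂)
  let e : PuncturedSurfaceGroup (g₀ + (g₁ + g₂)) r ⧸ K ≃*
      Coprod (PuncturedSurfaceGroup g₀ 0) (Coprod (PuncturedSurfaceGroup g₁ 0) (PuncturedSurfaceGroup g₂ 0)) :=
    (QuotientGroup.quotientQuotientEquivQuotient K₁ K hK₁K).symm.trans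
      ((QuotientGroup.congr _ _ e₁ hcongr).trans
        ((QuotientGroup.quotientMulEquivOfEq himg).trans (e₃.trans T3)))
  have hT3l : ∀ y : PuncturedSurfaceGroup g₀ 0, T3 (Coprod.inl y) = Coprod.inl y := fun y => by
    change (MulEquiv.coprodCongr _ _) (Coprod.inl y) = _
    rw [MulEquiv.coprodCongr_apply, Coprod.map_apply_inl]; rfl
  have hT3r : ∀ z : PuncturedSurfaceGroup (g₁ + g₂) 0,
      T3 (Coprod.inr (QuotientGroup.mk z)) = Coprod.inr (e₂ (QuotientGroup.mk z)) := fun z => by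
    change (MulEquiv.coprodCongr _ _) (Coprod.inr _) = _
    rw [MulEquiv.coprodCongr_apply, Coprod.map_apply_inr]; rfl
  have hemk : ∀ x : PuncturedSurfaceGroup (g₀ + (g₁ + g₂)) r,
      e (QuotientGroup.mk x) = T3 (e₃ (QuotientGroup.mk (θ x))) := fun x => by
    have h0 : (QuotientGroup.quotientQuotientEquivQuotient K₁ K hK₁K).symm (QuotientGroup.mk x) =
        QuotientGroup.mk (QuotientGroup.mk x) := by
      rw [MulEquiv.symm_apply_eq]
      exact (QuotientGroup.quotientQuotientEquivQuotientAux_mk_mk K₁ K hK₁K x).symm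
    change T3 (e₃ ((QuotientGroup.quotientMulEquivOfEq himg) ((QuotientGroup.congr _ _ e₁ hcongr)
      ((QuotientGroup.quotientQuotientEquivQuotient K₁ K hK₁K).symm (QuotientGroup.mk x))))) = _
    rw [h0, QuotientGroup.congr_mk]
    rfl
  refine ⟨hKn, e, fun i bit => ?_, fun j bit => ?_, fun k bit => ?_⟩
  · rw [hemk, hθapply, he₁l, he₃l, hT3l]
  · rw [hemk, hθapply, he₁r, he₃r, hT3r, he₂l]
  · rw [hemk, hθapply, he₁r, he₃r, hT3r, he₂r]

end PuncturedSurfaceGroup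

end Literature.GroupTheory.CombinatorialGroupTheory
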